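import Mathlib
import HarnessLib
import Literature.NumberTheory.GelbartRogawski1991.LocalAPackets

/-!
# Gelbart–Rogawski 1990 `[GR₁]` — the CITED ROWS, typed from HELD secondary sources

S. Gelbart, J. Rogawski, *Exceptional representations and Shimura's integral for the local unitary
group `U(3)`*, in: Festschrift in honor of I. I. Piatetski-Shapiro, Part I, Israel Math. Conf.
Proc. **2** (Weizmann, 1990) 19–75 [GelbartRogawski1990] (= `[GR₁]` of [GelbartRogawski1991],
`[GR90]` of [Liu2021], `[Ge2]` of [Haan2015], `[Ge-Ro1]` of [deShalitU21Lectures]) is **NOT HELD**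
on this hub (acquisitions acq-10743 / acq-13597 open).  This file types, at DICTIONARY LEVEL and
with BOTH locators in every docstring, exactly those numbered results of `[GR₁]` whose STATEMENT is
printed in a HELD source — chiefly the quotations inside [GelbartRogawski1991] (Invent. Math. 105,
read on the GDZ page images pp. 452, 453, 459, 461), E. de Shalit's open lecture notes
[deShalitU21Lectures] (Prop. 3.14, Thms. 4.29–4.30), Y. Liu [Liu2021, App. D, proof of Lemma D.1]
and the signed zbMATH review Zbl 0732.22014 (L. Corwin).  No page or theorem number of `[GR₁]`
itself is asserted beyond what those secondaries print.

## Transcription level (same discipline as `Literature.NumberTheory.GelbartRogawski1991.GR91LocalPacket`)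

Everything is LOCAL at one place `v` of `F` (`E_v = E ⊗_F F_v`, `G_v` the quasi-split `U(3)(F_v)`),
and is a predicate on the ★ dictionary `GR91LocalPacket` of
`Literature/NumberTheory/GelbartRogawski1991/LocalAPackets.lean` (REUSED, not re-posited: `LocRep`,
`Char1`, `OmegaHecke`, `weil γ_v ψ_v χ_v = ω(γ_v, ψ_v, χ_v)`, `pin η_v η′_v = πⁿ(ρ_v)`, `OccursU1`,
`NormClassEq`, `IsSplit`, `IsFinite`, …) together with at most one small bundle of further posited
primitives per group of rows: `HeisData Y` (Heisenberg models: `R_v^∧`, `B_v`-orbits,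
`Hom_{R_v}(π_v, τ_v) ≠ 0`, `τ(γ_v, ψ_v, χ_v)`), `PSData Y` (unramified places and
representations), `SplitData Y` (the `GL₃(F_v)`-model at a split
place).  Every printed statement is `def … : Prop` (class **P, as recalled**: the quotation of the
held secondary, verbatim, with its locator); `HeisData.IsLocallyExceptional` is a real DEFINITION
([GelbartRogawski1991] p. 452 L16–18); the two `theorem`s are unfolding lemmas by `Iff.rfl`/`rfl`.
NOTHING IS ASSERTED: a consumer takes `(h : prop511_localBijection Y)` as a hypothesis.
SCOPE as printed in the secondaries: `[GR₁]` is the theory of the LOCAL group over "a local field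
`F`, `E` a quadratic extension of `F`" (Zbl 0732.22014), i.e. a NON-SPLIT place; rows are typed
under `Y.IsFinite → ¬ Y.IsSplit` unless the held quotation itself says otherwise (p. 453: "for all
finite places `v`"; Liu's split-place row).

## Census of the `[GR₁]` rows cited in the tree / invoked by [GelbartRogawski1991] (decision)

* TYPED here: Prop. 5.1.1 (`prop511_localBijection`; = the content Liu cites as «Prop. 5.1.4» for
  Lemma D.1 (3) at `n = 3`), Prop. 5.1.6 (`prop516_unramified_locallyExceptional`), "Weil
  representations are (locally) exceptional" (`weil_locallyExceptional`, `weil_models`; premise `hasModel_union_of_orbits`), the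
  bijection `B_v\R_v^∧ ↔ Ω_v` (`orbitWeilBijection`), §8.1 (`sec81_unramified_weil_eq_pin`),
  Prop. 5.2.3 (`prop523_weil_eq_pin`), §2.6 split place (`sec26_split_weil_eq_ind`).
* ALREADY NAMED in the tree (cite, not restated): Prop. 5.2.2 =
  `Literature.NumberTheory.GelbartRogawski1991.GR91LocalPacket.gr1_prop522` and
  `Literature.NumberTheory.GelbartRogawski1991.GR90Prop522_thetaType_supercuspidal_iff`; the
  tree-object currency of Prop. 5.1.4 / Lemma D.1 (3) =
  `Literature.RepresentationTheory.MoeglinVignerasWaldspurger1987.rankOne_theta_lines_disjoint`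
  (PROVED, `…RankOneThetaLiftLinesDisjointHolds`) and `…rankOne_theta_twist_rigidity`.
* CARRIER-LEVEL (true by the typing `weil : … → LocRep`, `LocRep` = irreducible representations;
  not a separate predicate): §2 "each `G_v`-module `𝒮(χ_v, ψ_v)` is irreducible" (p. 459 L30;
  [deShalitU21Lectures] Thm. 3.13 (ii)), Prop. 2.5.1 (b) "nonzero and irreducible" ([Haan2015]
  Thm. 3.4 (i), p. 9); tree-object currency: [Liu2021] Lemma D.1 files
  (`Literature.NumberTheory.Automorphic.Liu2021.*IrreducibleOfLemD1*`).
* NOT TYPED — no held statement (WANTED, acq-10743): §1.2 (unramified `L`-factors; p. 450 is a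
  pointer only), Prop. 2.6.1 ([Haan2015] p. 15 "a similar argument"), Prop. 4.1.3 (p. 453 L2–4, a
  vector-level statement quoted only as used), Lemma 8.1.1 (a) (p. 452 L33–35, vector-level:
  "the space of `R(𝒪_v)`-fixed vectors in an unramified `τ_v` is one-dimensional"), the
  Whittaker-model and `GL₃` statements of the review (no numbers printed); Thms. 8.2.6 / 8.7.1
  (the unramified local Shimura integral) are restated on p. 464 as the local formula of
  [GelbartRogawski1991] Thm. 4.3.1 and belong with that theorem (`…GelbartRogawski1991.Sec4`).

## References

* [GelbartRogawski1990] S. Gelbart, J. Rogawski, Israel Math. Conf. Proc. 2 (1990) 19–75 — NOT held.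
* [GelbartRogawski1991] S. Gelbart, J. Rogawski, Invent. Math. 105 (1991) 445–472 (GDZ page images;
  `shelf/GR91-GelbartRogawski1991-Invent105.md`): p. 452 L24–27, p. 453 L28–30, p. 459 L30,
  p. 461 L8–18, L24–27, Remark p. 461 foot – p. 462 L2.
* [deShalitU21Lectures] E. de Shalit, *Lectures on representation theory and L functions for
  U(2,1)*, Hebrew Univ. notes: Prop. 3.14 (p. 28), Def. 4.1 (p. 41), Thms. 4.29–4.30 (p. 43).
* [Liu2021] Y. Liu, App. D: Lemma D.1 (l. 5226–5238), proof l. 5241 (split case, «[GR90, 2.6]»),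
  l. 5255 («[GR90, Proposition 5.1.4]»).
* [Haan2015] J. Haan, arXiv:1501.00885, Thm. 3.4 and its proof (p. 9).
* L. Corwin, review of [GelbartRogawski1990], Zbl 0732.22014 (quoted in
  `shelf/zbMATH-Reviews-CRM1992-GR90-MR92.md` §6).
-/

noncomputable section

namespace Literature.NumberTheory.GelbartRogawski1990.CitedRows

open Literature.NumberTheory.GelbartRogawski1991 (GR91LocalPacket)

universe u

variable (Y : GR91LocalPacket.{u})

/-! ## 1. The local bijection of Weil representations — `[GR₁, Prop. 5.1.1]` -/

/-- **P, as recalled — `[GR₁, Prop. 5.1.1]`, the LOCAL BIJECTION of Weil representations.**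
[GelbartRogawski1991, Remark p. 461 foot – p. 462 L2]: «we need only show that
`ω(γ, ψ, χ) = ω(γ′, ψ′, χ′)` if and only if `γ′ = γ`, `χ′ = χ`, and `ψ′ = ψ^δ` for some
`δ ∈ N_{E/F}(E*)`. This is clear from the local bijection ([GR₁, Prop. 5.1.1]), but with the
statement `ψ′ = ψ^δ` for some `δ ∈ N_{E/F}(I_E)`.»  Stated verbatim, locally, in
[deShalitU21Lectures, Prop. 3.14 (ii), p. 28]: «Two Weil representations `ω(γ, ψ, χ)` and
`ω(γ′, ψ′, χ′)` are equivalent if and only if `γ′ = γ`, `χ′ = χ` and `ψ′ = ψ_a` for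
`a ∈ N_{E/F}(E^×)`. Proof. For (ii) see [Ge-Ro2], Remark on the bottom of p.461 and [Ge-Ro1],
Proposition 5.1.1.»  The same statement in Liu's labels (`μ ↔ γ`, class of `ε ↔ ψ` mod norms,
`χ ↔ χ`) is [Liu2021, App. D Lemma D.1 (3)] «If `n ≥ 3`, then `ω(μ′, ε′, χ′)` is isomorphic to
`ω(μ, ε, χ)` if and only if `(μ′, ε′, χ′) = (μ, ε, χ)`», whose printed proof (l. 5255) is «it is
known when `n = 3` by [GR90, Proposition 5.1.4]» — so the tree's «[GelbartRogawski1990,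
Prop. 5.1.4]» tags point at this row; its tree-object currency is
`Literature.RepresentationTheory.MoeglinVignerasWaldspurger1987.rankOne_theta_lines_disjoint`
(the `ε`-clause, PROVED) and `…rankOne_theta_twist_rigidity`.  Typed on `GR91LocalPacket`
(`weil γ ψ χ : LocRep` are isomorphism classes, so "equivalent" is `=`; `NormClassEq ψ ψ′` is
«`ψ′ = ψ^δ`, `δ ∈ N_{E/F}(E_v*)`»), at a FINITE NON-SPLIT place (the setting of `[GR₁]`:
«`F` a local field, `E` a quadratic extension of `F`», Zbl 0732.22014).  One direction for the
`ψ`-variable alone is the ★ item `GR91LocalPacket.weil_normClass_const`.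
[cite: GelbartRogawski1990, Prop. 5.1.1 (as recalled in GelbartRogawski1991, Remark pp. 461–462)]
[cite: deShalitU21Lectures, Prop. 3.14 (ii) (p. 28)]
[cite: Liu2021, App. D Lemma D.1 (3) (l. 5233), proof l. 5255] -/
def prop511_localBijection : Prop :=
  Y.IsFinite → ¬ Y.IsSplit →
    ∀ (γ γ' : Y.OmegaHecke) (ψ ψ' : Y.AddChar) (χ χ' : Y.Char1),
      Y.weil γ ψ χ = Y.weil γ' ψ' χ' ↔ (γ' = γ ∧ χ' = χ ∧ Y.NormClassEq ψ ψ')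

/-! ## 2. Heisenberg models, local exceptionality — `[GR₁]` §§4–5 as quoted -/

/-- **Posited primitives for the Heisenberg-model rows** (nothing asserted).  Intended meaning at
the place `v` ([GelbartRogawski1991] §1.1 p. 449: `B` the upper-triangular Borel subgroup of `G`,
`N` its unipotent radical, `U` the centre of `N`, `R` the centralizer of `U` in `B`):
* `HeisRep` — «Locally, `R_v^∧` will denote the set of irreducible, infinite-dimensional
  representations of `R_v`» (p. 452 L9–10), up to isomorphism;
* `Orbit`, `orbit` — the set `B_v\R_v^∧` of `B_v`-orbits («`R` is normal in `B` and `B(F)` acts on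
  `R^∧`», p. 452 L4; «the set of orbits `B_v\R_v^∧`», p. 453 L29) and the orbit map;
* `HasModel π_v τ_v` — «A non-zero `R_v` map from `π_v` to `τ_v`, where `τ_v ∈ R_v^∧`, is called a
  Heisenberg model for `π_v`» (p. 452 L11–12): `Hom_{R_v}(π_v, τ_v) ≠ {0}`;
* `tauOf γ_v ψ_v χ_v` — the local component of `τ(γ, ψ, χ) ∈ R^∧` (p. 460 foot – p. 461 L3: the
  representation `τ(s′, ψ, χ)` of `R(𝔸)` on `{φ_v(zsn) = χ(z) θ¹(ω(sn)v)}`, «we can denote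
  `τ(s′, ψ, χ)` by `τ(γ, ψ, χ)`»); = `τ′ = χ ⊗ τ(γ, ψ)` of [deShalitU21Lectures, Thm. 4.29].
[cite: GelbartRogawski1991, §2.3 p. 452 L4–13; p. 453 L29; pp. 460–461] -/
structure HeisData (Y : GR91LocalPacket.{u}) : Type (u + 1) where
  /-- `R_v^∧`: irreducible infinite-dimensional representations of `R_v` -/
  HeisRep : Type u
  /-- `B_v\R_v^∧` -/
  Orbit : Type u
  /-- `τ_v ↦` its `B_v`-orbit -/
  orbit : HeisRep → Orbit
  /-- `Hom_{R_v}(π_v, τ_v) ≠ {0}` -/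
  HasModel : Y.LocRep → HeisRep → Prop
  /-- `τ(γ_v, ψ_v, χ_v)` -/
  tauOf : Y.OmegaHecke → Y.AddChar → Y.Char1 → HeisRep

namespace HeisData

variable {Y} (H : HeisData Y)

/-- **DEFINITION — locally exceptional** [GelbartRogawski1991, p. 452 L14–18]: «Observe that the
set of `τ_v` such that `Hom_{R_v}(π_v, τ_v) ≠ {0}` is a union of `B_v`-orbits in `R_v^∧`. If the
set of `τ_v ∈ R_v^∧` such that `Hom(π_v, τ_v) ≠ {0}` is a single `B_v`-orbit, then `π_v` is called
locally exceptional.»  (= the notion of `[GR₁]`, Zbl 0732.22014: «an irreducible admissible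
representation `π` of `G` is called exceptional if `Hom_R(π, γ) ≠ 0` only for `γ` in a single
`B`-orbit of `R^`»; [deShalitU21Lectures, Def. 4.1]: «We call `π` exceptional if `|Ω(π)| = 1`».)
Typed: the set of orbits met by the Heisenberg models of `π_v` is a singleton — some model exists
and all models lie in one orbit.
[cite: GelbartRogawski1991, §2.3 p. 452 L14–18] -/
def IsLocallyExceptional (π : Y.LocRep) : Prop :=
  ∃ τ₀ : H.HeisRep, H.HasModel π τ₀ ∧ ∀ τ : H.HeisRep, H.HasModel π τ → H.orbit τ = H.orbit τ₀

/-- Unfolding of `IsLocallyExceptional`. [cite: GelbartRogawski1991, §2.3 p. 452 L14–18] -/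
theorem isLocallyExceptional_iff (π : Y.LocRep) :
    H.IsLocallyExceptional π ↔
      ∃ τ₀ : H.HeisRep, H.HasModel π τ₀ ∧ ∀ τ : H.HeisRep, H.HasModel π τ → H.orbit τ = H.orbit τ₀ :=
  Iff.rfl

end HeisData

variable {Y}

/-- **P — the Heisenberg models of `π_v` form a union of `B_v`-orbits** [GelbartRogawski1991,
p. 452 L14–15]: «Observe that the set of `τ_v` such that `Hom_{R_v}(π_v, τ_v) ≠ {0}` is a union of
`B_v`-orbits in `R_v^∧`.»  (The premise under which «is a single `B_v`-orbit» and
`HeisData.IsLocallyExceptional` say the same thing.)  Typed: `HasModel π_v` is constant on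
`B_v`-orbits.
[cite: GelbartRogawski1991, §2.3 p. 452 L14–15] -/
def hasModel_union_of_orbits (H : HeisData Y) : Prop :=
  ∀ (π : Y.LocRep) (τ τ' : H.HeisRep), H.orbit τ = H.orbit τ' → (H.HasModel π τ ↔ H.HasModel π τ')

/-- **P, as recalled — Weil representations are locally exceptional** (`[GR₁]`; Zbl 0732.22014:
«The authors show that Weil representations are exceptional»).  [GelbartRogawski1991, proof of
Thm. 3.4 (b), p. 461 L24–27]: «Now recall that `π_v = ω(γ_v, ψ_v, χ_v)` is locally exceptional for
each finite `v`. (In [Gr₁] [sic], we showed that `π_v` is locally exceptional for all finite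
non-split `v`; however the argument easily adapts to the split case.)»  [deShalitU21Lectures,
Thm. 4.29, p. 43]: «The Weil representation `π = ω(γ, ψ, χ)` is exceptional.»  Typed: what
`[GR₁]` is quoted to prove — finite NON-SPLIT `v` (the split case, p. 461 L25–26, is
[GelbartRogawski1991]'s own remark, not a `[GR₁]` row — not typed here).
[cite: GelbartRogawski1990, no locator printed (as recalled in GelbartRogawski1991, p. 461 L24–27; Zbl 0732.22014)]
[cite: deShalitU21Lectures, Thm. 4.29 (p. 43)] -/
def weil_locallyExceptional (H : HeisData Y) : Prop :=
  Y.IsFinite → ¬ Y.IsSplit →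
    ∀ (γ : Y.OmegaHecke) (ψ : Y.AddChar) (χ : Y.Char1), H.IsLocallyExceptional (Y.weil γ ψ χ)

/-- **P, as recalled — the Heisenberg model of `ω(γ_v, ψ_v, χ_v)` is `τ(γ_v, ψ_v, χ_v)`, and it
determines `γ_v`.**  [deShalitU21Lectures, Thm. 4.29, p. 43]: «Moreover, let
`τ′ = χ ⊗ τ(γ, ψ)` be the representation of `R′ = CR` … Then `Ω(π) = {τ′}`» (for
`π = ω(γ, ψ, χ)`); [GelbartRogawski1991, proof of Thm. 3.4 (b), p. 461 L22–27]: «`τ₁ = τ(γ₁, ψ, χ)`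
and `τ₁` [sic] `= τ(γ₂, ψ, χ)` for some `ψ`, where `χ` is the central character of `π`. Now recall
that `π_v = ω(γ_v, ψ_v, χ_v)` is locally exceptional for each finite `v` … Since `τ_{1v}` and
`τ_{2v}` belong to `Λ(π_v)`, this implies `γ_{1v} = γ_{2v}`.»  Typed (finite non-split `v`),
the two printed sentences: `ω(γ_v, ψ_v, χ_v)` has a Heisenberg model of type `τ(γ_v, ψ_v, χ_v)`
(de Shalit); and if `τ(γ₁, ψ₀, χ_v)` and `τ(γ₂, ψ₀, χ_v)` (same `ψ₀`, `χ_v` the central character)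
are both Heisenberg models of `ω(γ_v, ψ_v, χ_v)`, then `γ₁ = γ₂` (GR91 p. 461 L26–27).  No
`[GR₁]` number is printed for this statement.
[cite: GelbartRogawski1990, no locator printed (as recalled in GelbartRogawski1991, p. 461 L22–27)]
[cite: deShalitU21Lectures, Thm. 4.29 (p. 43)] -/
def weil_models (H : HeisData Y) : Prop :=
  Y.IsFinite → ¬ Y.IsSplit →
    ∀ (γ : Y.OmegaHecke) (ψ : Y.AddChar) (χ : Y.Char1),
      H.HasModel (Y.weil γ ψ χ) (H.tauOf γ ψ χ) ∧
        ∀ (ψ₀ : Y.AddChar) (γ₁ γ₂ : Y.OmegaHecke),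
          H.HasModel (Y.weil γ ψ χ) (H.tauOf γ₁ ψ₀ χ) →
            H.HasModel (Y.weil γ ψ χ) (H.tauOf γ₂ ψ₀ χ) → γ₁ = γ₂

/-- **P, as recalled — the bijection `B_v\R_v^∧ ↔ Ω_v`.**  [GelbartRogawski1991, §2.5 p. 453
L28–30]: «We have shown in [GR₁] that there is a bijection between the set of orbits `B_v \ R_v^∧`
and the set `Ω_v` of Weil representations of `G_v` for all finite places `v`. Let `ω(τ_v)` be the
Weil representation corresponding to the orbit of `τ_v`.»  [deShalitU21Lectures, Thm. 4.30,
p. 43]: «There is a bijection `ω(γ, ψ, χ) ↔ τ(γ, ψ, χ) = χ ⊗ τ(γ, ψ)` between Weil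
representations and `T`-orbits in `R̂′`»; Zbl 0732.22014: «one gets a natural correspondence
between the set of Weil representations and `B`[-orbits in]`R^`».  Typed (every finite `v`, as
printed on p. 453): an equivalence between `Orbit` and
`Ω_v = {ω(γ_v, ψ_v, χ_v)} ⊆ LocRep` sending the orbit of `τ(γ_v, ψ_v, χ_v)` to `ω(γ_v, ψ_v, χ_v)`.
[cite: GelbartRogawski1990, no locator printed (as recalled in GelbartRogawski1991, p. 453 L28–30; Zbl 0732.22014)]
[cite: deShalitU21Lectures, Thm. 4.30 (p. 43)] -/
def orbitWeilBijection (H : HeisData Y) : Prop :=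
  Y.IsFinite →
    ∃ e : H.Orbit ≃ {π : Y.LocRep // ∃ (γ : Y.OmegaHecke) (ψ : Y.AddChar) (χ : Y.Char1),
        π = Y.weil γ ψ χ},
      ∀ (γ : Y.OmegaHecke) (ψ : Y.AddChar) (χ : Y.Char1),
        (e (H.orbit (H.tauOf γ ψ χ)) : Y.LocRep) = Y.weil γ ψ χ

/-! ## 3. Unramified representations; the non-tempered member — `[GR₁]` Prop. 5.1.6, §8.1, Prop. 5.2.3 -/

/-- **Posited primitives for the unramified rows** (nothing asserted):
* `IsUnramifiedPlace` — «`v` is … unramified in `E`» (p. 452 L25);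
* `IsUnramified π_v` — `π_v` is unramified, i.e. has a non-zero vector fixed by `K_v`, «the subgroup
  of integral points in `G_v`» ([GelbartRogawski1991] §3.1 p. 454 L38–39; p. 452 L36 «`x_v°` is a
  `K_v`-fixed vector in `π_v`»).
No principal-series socket is posited: the Langlands quotients that occur in the rows below are, by
the definition of `πⁿ(ρ_v)` (§1.4 p. 450), members `Y.pin η η'` of the ★ dictionary (see
`prop523_weil_eq_pin`).
[cite: GelbartRogawski1991, p. 452 L25, L36; §3.1 p. 454 L38–39] -/
structure PSData (Y : GR91LocalPacket.{u}) : Type u where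
  /-- `v` is unramified in `E` -/
  IsUnramifiedPlace : Prop
  /-- `π_v` has a non-zero `K_v`-fixed vector -/
  IsUnramified : Y.LocRep → Prop

/-- **P, as recalled — `[GR₁, Prop. 5.1.6]`.**  [GelbartRogawski1991, proof of Thm. 2.4.1, p. 452
L24–27]: «On the other hand, by [GR₁, Proposition 5.1.6.], if `v` is non-split and unramified in
`E`, then an unramified locally exceptional representation of `G_v` is of the form `πⁿ(ρ_v)`.»
(`ρ_v` «some one-dimensional representation `ρ_v` of `H_v`», p. 452 L23; in the dictionary
`πⁿ(ρ_v) = pin η_v η′_v` for `ρ_v((h₂, h₁)) = η_v(det h₂) η′_v(det(h₂) h₁)`.)  Typed at a finite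
non-split `v` unramified in `E`.
[cite: GelbartRogawski1990, Prop. 5.1.6 (as recalled in GelbartRogawski1991, p. 452 L24–27)]
[cite: GelbartRogawski1991, proof of Thm. 2.4.1, p. 452 L24–27] -/
def prop516_unramified_locallyExceptional (H : HeisData Y) (P : PSData Y) : Prop :=
  Y.IsFinite → ¬ Y.IsSplit → P.IsUnramifiedPlace →
    ∀ π : Y.LocRep, P.IsUnramified π → H.IsLocallyExceptional π →
      ∃ η η' : Y.Char1, π = Y.pin η η'

/-- **P, as recalled — `[GR₁, §8.1]`: an unramified local Weil representation at a non-split place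
is `πⁿ(ρ_v)`.**  [GelbartRogawski1991, proof of Thm. 3.4 (a), p. 461 L8–10]: «let
`π = ω(γ, ψ, χ)`. If `v` is non-split and `π_v` is unramified, then `π_v` is isomorphic to `πⁿ(ρ_v)`
for some character of `H_v` by [GR₁], §8.1».  Typed at a finite non-split `v` for the local Weil
representation `ω(γ_v, ψ_v, χ_v)` (`= π_v`, §3.4 p. 459).
[cite: GelbartRogawski1990, §8.1 (as recalled in GelbartRogawski1991, p. 461 L8–10)]
[cite: GelbartRogawski1991, proof of Thm. 3.4 (a), p. 461 L8–10] -/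
def sec81_unramified_weil_eq_pin (P : PSData Y) : Prop :=
  Y.IsFinite → ¬ Y.IsSplit →
    ∀ (γ : Y.OmegaHecke) (ψ : Y.AddChar) (χ : Y.Char1), P.IsUnramified (Y.weil γ ψ χ) →
      ∃ η η' : Y.Char1, Y.weil γ ψ χ = Y.pin η η'

/-- **P, as recalled — `[GR₁, Prop. 5.2.3]`: when `χ_v(γ_v¹)⁻¹` occurs in `ω¹(γ_v, ψ_v)`, the local
Weil representation is the non-tempered member `πⁿ(ρ_v)`.**  [GelbartRogawski1991, proof of
Thm. 3.4 (a), p. 461 L14–19]: «On the other hand, if `χ_v(γ_v¹)⁻¹` occurs in `(ω_ψ^{s′})_v`, where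
`γ¹` is the restriction of `γ` to `E¹`, then by [GR₁], Proposition 5.2.3, the Weil representation
of `π_v` is the Langlands quotient of the principal series representation induced from
`ξ_v(d(α, β, ᾱ⁻¹)) = γ_v(α) χ_v γ_v⁻¹(β) ‖α‖_v^{1/2}`. For such `v`, `γ_v = μ_v η_{Ev} η′_{Ev}`.»
(`(ω_ψ^{s′})_v` = the oscillator representation `ω¹(γ_v, ψ_v)` of `U(1)(F_v)` for the lifting `s′`
determined by `(γ, ψ)`, §3.2 (3.2.1) p. 457 and p. 467 L6–9 — the dictionary's `OccursU1`;
`χ_v γ_v⁻¹(β)`, `β ∈ E_v¹`, is the character `χ_v (γ_v¹)⁻¹`.)  READING: by the definition of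
`πⁿ(ρ_v)` (§1.4 p. 450: «the Langlands quotient of the principal series representation induced
from the character `ν` of `B_v` defined by
`ν(d(α, β, ᾱ⁻¹)) = μ_v(α) η_v(α/ᾱ) η′_v((α/ᾱ)β) ‖α‖_v^{1/2}`» `= (μ_v η_{vE} η′_{vE})(α) η′_v(β) ‖α‖_v^{1/2}`)
that Langlands quotient is `πⁿ(ρ_v) = Y.pin η η'` for `ρ_v = (η_v, η′_v)` with
`μ_v η_{vE} η′_{vE} = γ_v` (`Y.gammaOf η η' = γ`) and `η′_v = χ_v(γ_v¹)⁻¹` — typed in that currency,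
so that no principal-series socket floats (T-ref3 QA-2).  This is the primary-source, `hn`-free
form of the (←) direction of the ★ K-item `GR91LocalPacket.weil_eq_pin_iff` (which DERIVES it from
`lemma512`, `packetShape`, `pis_supercuspidal`, `gr1_prop522` under a displayed hypothesis) — do
not file it a third time.  Typed at a finite non-split `v`.
[cite: GelbartRogawski1990, Prop. 5.2.3 (as recalled in GelbartRogawski1991, p. 461 L14–19)]
[cite: GelbartRogawski1991, proof of Thm. 3.4 (a), p. 461 L14–19; §1.4 p. 450] -/
def prop523_weil_eq_pin (Y : GR91LocalPacket.{u}) : Prop :=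
  Y.IsFinite → ¬ Y.IsSplit →
    ∀ (γ : Y.OmegaHecke) (ψ : Y.AddChar) (χ : Y.Char1),
      Y.OccursU1 γ ψ (χ * (Y.res1 γ)⁻¹) →
        ∃ η η' : Y.Char1, Y.gammaOf η η' = γ ∧ η' = χ * (Y.res1 γ)⁻¹ ∧ Y.weil γ ψ χ = Y.pin η η'

/-! ## 4. The split place — `[GR₁, §2.6]` as cited by [Liu2021] -/

/-- **Posited primitives for the split-place row** (nothing asserted).  At a place `v` that splits
in `E` [Liu2021, App. D, proof of Lemma D.1, l. 5241]: «We consider first the case where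
`E = F × F`. We identify `U(V)` with `GL_n(F)` and `E⁻` with `F` through the first factor; and write
`μ = ν ⊠ ν⁻¹`. Note that the first component of `χ̌` is simply `χ`.»  Fields: `FChar` — characters
of `F_v^×`; `nuOf γ_v` — the `ν` with `γ_v = ν ⊠ ν⁻¹` (Liu's `μ` = the splitting character `γ_v` of
`E_v^× = F_v^× × F_v^×` trivial on `F_v^×`); `chiF χ_v` — the character `χ` of `E_v¹ ≅ F_v^×` read on
the first factor; `indQ21 ν λ` — the unitary induction from `Q_{2,1}(F_v)` (standard parabolic of
`GL₃` with Levi `GL₂ × GL₁`) to `GL₃(F_v) ≅ G_v` of the unitary character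
`(ν ∘ det) ⊠ λ ν⁻²` of `GL₂(F_v) × GL₁(F_v)`.
[cite: Liu2021, App. D proof of Lemma D.1, l. 5241 (p. 126)] -/
structure SplitData (Y : GR91LocalPacket.{u}) : Type (u + 1) where
  /-- characters of `F_v^×` -/
  FChar : Type u
  /-- `γ_v = ν ⊠ ν⁻¹ ↦ ν` -/
  nuOf : Y.OmegaHecke → FChar
  /-- `χ_v ↦` its first component -/
  chiF : Y.Char1 → FChar
  /-- `(ν, λ) ↦ Ind_{Q_{2,1}(F_v)}^{GL₃(F_v)} ((ν ∘ det) ⊠ λ ν⁻²)` (unitary induction) -/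
  indQ21 : FChar → FChar → Y.LocRep

/-- **P, as recalled — `[GR₁, §2.6]`, the split-place model of the local Weil representation.**
[Liu2021, App. D, proof of Lemma D.1, l. 5241 (p. 126)]: «Then `ω(μ, ε, χ)` is isomorphic to the
unitary induction from `Q_{n−1,1}(F)` to `GL_n(F)` of the (unitary) character
`(ν ∘ det) ⊠ χ ν^{1−n}` of `GL_{n−1}(F) × GL_1(F)` (hence of `Q_{n−1,1}(F)`). See for example
[GR90, 2.6]. The lemma follows from such description.»  Typed at `n = 3` (the case of `[GR₁]`) on
the dictionary: at a finite split `v`, `ω(γ_v, ψ_v, χ_v) = Ind_{Q_{2,1}}^{GL₃}((ν ∘ det) ⊠ χ ν⁻²)`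
with `γ_v = ν ⊠ ν⁻¹` — in particular independent of `ψ_v` (cf. Lemma 5.1.2: «If `v` is split,
`Π(ρ_v)` is a singleton», p. 466).  Tree-object currency of the split case of Lemma D.1:
`Literature.NumberTheory.Automorphic.Liu2021.LemD1SplitPlaceOfFacts` (proved there).
[cite: GelbartRogawski1990, §2.6 (as cited in Liu2021, App. D proof of Lem. D.1, l. 5241)]
[cite: Liu2021, App. D proof of Lemma D.1, l. 5241 (p. 126)] -/
def sec26_split_weil_eq_ind (S : SplitData Y) : Prop :=
  Y.IsFinite → Y.IsSplit →
    ∀ (γ : Y.OmegaHecke) (ψ : Y.AddChar) (χ : Y.Char1),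
      Y.weil γ ψ χ = S.indQ21 (S.nuOf γ) (S.chiF χ)

end Literature.NumberTheory.GelbartRogawski1990.CitedRows

end
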